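import Mathlib.LinearAlgebra.Matrix.Determinant.Basic
import Mathlib.LinearAlgebra.Matrix.Adjugate
import Mathlib.Data.Matrix.Basic
import Mathlib.Algebra.BigOperators.Fin
import Mathlib.Tactic.Ring

/-!
# `(3,4)` symmetric pencils — the tangent cone of the cubic symmetroid at a rank-one point (engine-5 g12, E5G12-SYMNODE §2.4 CONE LEMMA, algebraic core)

HONEST FRAMING.  Object-search cell `pub-symmetroid`, beside ONE typed statement `DoorA34 = PosRootLawAt 3 4 18`
(OPEN, never asserted).  Elementary exact algebra behind the cell's CONE LEMMA: for `3 × 3` matrices over a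
commutative ring, `det (v vᵀ + ε W) = ε² · vᵀ adj(W) v + ε³ · det W` — the determinant vanishes to second
order at a rank-one point and its leading form is the quadratic form `W ↦ vᵀ adj(W) v`, which for `v = e₃` is the
`2 × 2` minor `W₀₀ W₁₁ − W₀₁ W₁₀` of the compression of `W` to `v^⊥` (signature `(1,2)` on symmetric `W` over `ℝ`:
the node is SPLIT).  No bound on any root count; nothing on `MatrixDescartes` (stmt-ValiantsHypothesis-18050) / `VP ≠ VNP`.

[folklore] multilinearity of `det` at a rank-one matrix.
-/

-- `Summit.ValiantsHypothesis.ValiantsHypothesis.…` repeats a component by the D-0017 layout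
-- (single-conjunct summit), which the `dupNamespace` linter flags; the name is mandated.
set_option linter.dupNamespace false

namespace Summit.ValiantsHypothesis.ValiantsHypothesis.Theorems.LacunarySymmetroidMatrixDescartes.Census

open Matrix

/-- **Determinant near a rank-one point (`3 × 3`).**  `det (vecMulVec v v + ε • W) = ε² · (v ⬝ᵥ adj(W) *ᵥ v) + ε³ · det W`:
no constant and no linear term — a rank-one matrix is a singular point of `{det = 0}` — and the quadratic term is
`vᵀ adj(W) v`. -/
theorem det_vecMulVec_add_smul {R : Type*} [CommRing R] (v : Fin 3 → R) (W : Matrix (Fin 3) (Fin 3) R) (ε : R) :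
    (Matrix.vecMulVec v v + ε • W).det = ε ^ 2 * (v ⬝ᵥ (W.adjugate *ᵥ v)) + ε ^ 3 * W.det := by
  simp only [Matrix.det_fin_three, Matrix.adjugate_fin_three, Matrix.add_apply, Matrix.vecMulVec_apply,
    Matrix.smul_apply, smul_eq_mul, Matrix.mulVec, dotProduct, Fin.sum_univ_three, Matrix.of_apply,
    Matrix.cons_val', Matrix.cons_val_zero, Matrix.cons_val_one, Matrix.head_cons, Matrix.cons_val_two,
    Matrix.tail_cons, Matrix.empty_val', Matrix.cons_val_fin_one, Matrix.head_fin_const]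
  ring

/-- The quadratic form of the tangent cone in the frame `v = e₃ = (0,0,1)`: `vᵀ adj(W) v` is the `2 × 2` minor
`W₀₀ W₁₁ − W₀₁ W₁₀` — the determinant of the compression of `W` to `v^⊥ = ⟨e₁, e₂⟩`. -/
theorem adjugate_quadForm_e3 {R : Type*} [CommRing R] (W : Matrix (Fin 3) (Fin 3) R) :
    (![0, 0, 1] ⬝ᵥ (W.adjugate *ᵥ ![0, 0, 1])) = W 0 0 * W 1 1 - W 0 1 * W 1 0 := by
  simp only [Matrix.adjugate_fin_three, Matrix.mulVec, dotProduct, Fin.sum_univ_three, Matrix.of_apply,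
    Matrix.cons_val', Matrix.cons_val_zero, Matrix.cons_val_one, Matrix.head_cons, Matrix.cons_val_two,
    Matrix.tail_cons, Matrix.empty_val', Matrix.cons_val_fin_one, Matrix.head_fin_const]
  ring

end Summit.ValiantsHypothesis.ValiantsHypothesis.Theorems.LacunarySymmetroidMatrixDescartes.Census
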